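import Summits.AtomisticToContinuum.BoseEinsteinCondensation.Theorems.BECCutLineWeakDisorderTwoReplicaTransienceBoundSausageMoment
import Literature.Probability.Process.BrownianIncrementSup
import HarnessLib

/-!
# Crux `TwoReplicaTransienceBound` (stmt-AtomisticToContinuum-9687): the per-slice cubic
# Wiener-sausage moment, uniform in the slice start

Support file (does not close the item) for the crux
`Summit.AtomisticToContinuum.BoseEinsteinCondensation.Theses.BECCutLineWeakDisorder.TwoReplicaTransienceBound`
(route `BECCutLineWeakDisorder`, line `SketchIdeator1`, skeleton v7, lead c4): the registered stub
`stub_sliceMoment` of the time-sliced insertion recursion.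

Skeleton v7 slices the time axis into slices `[u, u + h]` and covers the reach of a bath Brownian
line on each slice by a ball of radius `R + √2·(S(ω₀) + S(ω))`, `S(ω) = Σ_{c<3} incRunSup u h (ω c)`,
where `incRunSup u h η = sup_{v ≤ h} |b_{u+v}(η) − b_u(η)|` is the running supremum of the INCREMENTS
after time `u` of one Brownian coordinate (`Literature.Probability.Process.incRunSup`). This file is
the exact analogue of the `SausageMoment` file (skeleton v6, running suprema on `[0, h]`) for the
increments, and proves that the cubic moment of that radius over two independent lines is bounded
by the SAME explicit constant, uniformly in `u`:

* `SliceMoment.lintegral_incRunSup_pow_four_le` — **`E[(incRunSup u h)⁴] ≤ 18 h²`**: Doob's `L²`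
  maximal inequality (`doob_lintegral_iSup_sq_le_of_continuous`) for the increment martingale
  `M_v = (B_{u+v} − B_u)² − v` of the shifted filtration (`martingale_sqIncr_shift`) gives
  `E[sup_{v ≤ h} M_v²] ≤ 4 E[M_h²] = 8 h²` (`integral_sqIncr_shift_sq`), and pointwise
  `(B_{u+v} − B_u)⁴ ≤ 2 M_v² + 2 h²` for `v ≤ h`;
* `SliceMoment.sum_incRunSup_pow_four_le` — `(Σ_{c<3} M_c)⁴ ≤ 27 Σ_c M_c⁴` (power mean);
* `SliceMoment.ofReal_slice_cube_le` — the pointwise bound of the integrand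
  (`SausageMoment.sausage_cube_le`, `4096 · 27 = 110592`);
* `SliceMoment.lintegral_incRunSup_apply_pow_four_le` — one-coordinate marginal of `wienerLine`
  (`MeasureTheory.measurePreserving_eval`);
* `SliceMoment.lintegral_slice_cube_le` and the registered `TracerDecoupling.stub_sliceMoment` —
  `∫∫ ofReal ((2(R + √2(S(ω₀) + S(ω))))³) ≤ ofReal (1 + 128 R⁴) + 2 · (110592 · (3 · ofReal (18 h²)))`
  (`SausageMoment.lintegral_lintegral_le_of_le_add`).

## References

* D. Revuz, M. Yor, *Continuous Martingales and Brownian Motion* (1999), Ch. II Prop. (1.2),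
  Thm (1.7) (the increment martingales; Doob's `Lᵖ` inequality). [RevuzYor1999]
-/

noncomputable section

open MeasureTheory Set Filter
open scoped ENNReal NNReal BigOperators

namespace Summit.AtomisticToContinuum.BoseEinsteinCondensation.Cruxes.TwoReplicaTransienceBound.TracerDecoupling.SliceMoment

open Literature.Probability.Process (incRunSup preWienerMeasure measurable_incRunSup' incRunSup_nonneg
  brownian continuous_brownian dyadTime dyadTime_le bddAbove_range_abs_incr_dyad martingale_sqIncr_shift
  integral_sqIncr_shift_sq memLp_two_brownian_sub_sq doob_lintegral_iSup_sq_le_of_continuous)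
open Literature.Probability.RandomPlanarGeometry (brownianFiltration)

/-! ### The fourth moment of the running supremum of the increments -/

/-- **`E[(incRunSup u h)⁴] ≤ 18 h²`**, uniformly in the start `u`: Doob's `L²` maximal inequality for
the increment martingale `M_v = (B_{u+v} − B_u)² − v` (shifted filtration `𝓕ᵂ(u + ·)`) gives
`E[sup_{v≤h} M_v²] ≤ 4 E[M_h²] = 8h²`, and pointwise `(B_{u+v} − B_u)⁴ ≤ 2 M_v² + 2h²` for `v ≤ h`.
[cite: RevuzYor1999, Ch. II Thm (1.7)] -/
theorem lintegral_incRunSup_pow_four_le (u h : ℝ≥0) :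
    ∫⁻ ω, ENNReal.ofReal (incRunSup u h ω ^ 4) ∂preWienerMeasure ≤ ENNReal.ofReal (18 * (h : ℝ) ^ 2) := by
  haveI := Literature.Probability.RandomPlanarGeometry.isProbabilityMeasure_preWienerMeasure'
  -- Doob for the martingale `M_v = (B_{u+v} - B_u)² − v`
  set M : ℝ≥0 → (ℝ≥0 → ℝ) → ℝ := fun v ω ↦ (brownian (u + v) ω - brownian u ω) ^ 2 - (v : ℝ) with hM
  have hmart : Martingale M (brownianFiltration.addLeft u) preWienerMeasure := martingale_sqIncr_shift u
  have hL2 : ∀ v, MemLp (M v) 2 preWienerMeasure := fun v ↦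
    (memLp_two_brownian_sub_sq u (u + v)).sub (memLp_const _)
  have hcont : ∀ᵐ ω ∂preWienerMeasure, Continuous fun v ↦ M v ω :=
    Eventually.of_forall fun ω ↦ ((((continuous_brownian ω).comp (continuous_const.add continuous_id)).sub
      continuous_const).pow 2).sub NNReal.continuous_coe
  have hD := doob_lintegral_iSup_sq_le_of_continuous hmart hL2 hcont h
  have hMh : ∫⁻ ω, ENNReal.ofReal (M h ω ^ 2) ∂preWienerMeasure = ENNReal.ofReal (2 * (h : ℝ) ^ 2) := by
    have hint : Integrable (fun ω ↦ M h ω ^ 2) preWienerMeasure := (hL2 h).integrable_sq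
    rw [← ofReal_integral_eq_lintegral_ofReal hint (Eventually.of_forall fun ω ↦ sq_nonneg _),
      ← integral_sqIncr_shift_sq u h]
  rw [hMh] at hD
  -- pointwise: `ofReal (incRunSup⁴) ≤ 2 ⨆_{v ≤ h} ofReal (M_v²) + ofReal (2h²)`
  have hpt : ∀ ω, ENNReal.ofReal (incRunSup u h ω ^ 4) ≤
      2 * (⨆ s ∈ Set.Iic h, ENNReal.ofReal (M s ω ^ 2)) + ENNReal.ofReal (2 * (h : ℝ) ^ 2) := by
    intro ω
    have hbdd := bddAbove_range_abs_incr_dyad u h ω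
    set F : ℝ → ℝ≥0∞ := fun x ↦ ENNReal.ofReal (max x 0 ^ 4) with hF
    have hFmono : Monotone F := fun x y hxy ↦ by
      simp only [hF]
      exact ENNReal.ofReal_le_ofReal (pow_le_pow_left₀ (le_max_right _ _) (max_le_max hxy le_rfl) 4)
    have hFcont : Continuous F :=
      ENNReal.continuous_ofReal.comp ((continuous_id.max continuous_const).pow 4)
    have h1 := Monotone.map_ciSup_of_continuousAt (f := F) hFcont.continuousAt hFmono hbdd
    have hFrun : F (incRunSup u h ω) = ENNReal.ofReal (incRunSup u h ω ^ 4) := by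
      simp only [hF, max_eq_left (incRunSup_nonneg u h ω)]
    rw [← hFrun, incRunSup, h1]
    refine iSup_le fun p ↦ ?_
    set s := dyadTime h p.1 p.2 with hs
    have hsh : s ≤ h := dyadTime_le h p.1 p.2
    have hrw : F |brownian (u + s) ω - brownian u ω| =
        ENNReal.ofReal ((brownian (u + s) ω - brownian u ω) ^ 4) := by
      simp only [hF]
      rw [max_eq_left (abs_nonneg (brownian (u + s) ω - brownian u ω))]
      congr 1
      have := sq_abs (brownian (u + s) ω - brownian u ω)
      nlinarith [this]
    rw [hrw]
    -- `(B_{u+s} - B_u)⁴ ≤ 2 M_s² + 2 h²`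
    have hineq : (brownian (u + s) ω - brownian u ω) ^ 4 ≤ 2 * M s ω ^ 2 + 2 * (h : ℝ) ^ 2 := by
      simp only [hM]
      have hs' : (s : ℝ) ≤ h := NNReal.coe_le_coe.2 hsh
      have hs0 : (0 : ℝ) ≤ s := s.coe_nonneg
      nlinarith [sq_nonneg ((brownian (u + s) ω - brownian u ω) ^ 2 - s - s),
        sq_nonneg (brownian (u + s) ω - brownian u ω)]
    calc ENNReal.ofReal ((brownian (u + s) ω - brownian u ω) ^ 4)
        ≤ ENNReal.ofReal (2 * M s ω ^ 2 + 2 * (h : ℝ) ^ 2) := ENNReal.ofReal_le_ofReal hineq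
      _ = 2 * ENNReal.ofReal (M s ω ^ 2) + ENNReal.ofReal (2 * (h : ℝ) ^ 2) := by
          rw [ENNReal.ofReal_add (by positivity) (by positivity), ENNReal.ofReal_mul zero_le_two,
            ENNReal.ofReal_ofNat]
      _ ≤ 2 * (⨆ s ∈ Set.Iic h, ENNReal.ofReal (M s ω ^ 2)) + ENNReal.ofReal (2 * (h : ℝ) ^ 2) := by
          gcongr
          exact le_iSup₂_of_le (f := fun s (_ : s ∈ Set.Iic h) ↦ ENNReal.ofReal (M s ω ^ 2)) s
            (show s ∈ Set.Iic h from hsh) le_rfl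
  -- integrate
  calc ∫⁻ ω, ENNReal.ofReal (incRunSup u h ω ^ 4) ∂preWienerMeasure
      ≤ ∫⁻ ω, (2 * (⨆ s ∈ Set.Iic h, ENNReal.ofReal (M s ω ^ 2)) +
          ENNReal.ofReal (2 * (h : ℝ) ^ 2)) ∂preWienerMeasure := lintegral_mono hpt
    _ = 2 * ∫⁻ ω, (⨆ s ∈ Set.Iic h, ENNReal.ofReal (M s ω ^ 2)) ∂preWienerMeasure +
          ENNReal.ofReal (2 * (h : ℝ) ^ 2) := by
        rw [lintegral_add_right _ measurable_const, lintegral_const_mul' _ _ ENNReal.ofNat_ne_top,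
          lintegral_const, measure_univ, mul_one]
    _ ≤ 2 * (4 * ENNReal.ofReal (2 * (h : ℝ) ^ 2)) + ENNReal.ofReal (2 * (h : ℝ) ^ 2) := by
        gcongr
    _ = ENNReal.ofReal (18 * (h : ℝ) ^ 2) := by
        rw [← ENNReal.ofReal_ofNat 4, ← ENNReal.ofReal_ofNat 2, ← ENNReal.ofReal_mul (by norm_num),
          ← ENNReal.ofReal_mul (by norm_num), ← ENNReal.ofReal_add (by positivity) (by positivity)]
        congr 1
        ring

/-! ### The pointwise bound of the integrand -/

/-- **Power mean over the three coordinates**: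
`(Σ_{c<3} incRunSup u h (ω c))⁴ ≤ 27 Σ_c incRunSup u h (ω c)⁴`
(`pow_sum_le_card_mul_sum_pow`, the summands being nonnegative). [folklore] -/
theorem sum_incRunSup_pow_four_le (u h : ℝ≥0) (ω : Fin 3 → (ℝ≥0 → ℝ)) :
    (∑ c, incRunSup u h (ω c)) ^ 4 ≤ 27 * ∑ c, incRunSup u h (ω c) ^ 4 := by
  calc (∑ c, incRunSup u h (ω c)) ^ 4
      ≤ ((Finset.univ : Finset (Fin 3)).card : ℝ) ^ 3 * ∑ c, incRunSup u h (ω c) ^ 4 :=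
        pow_sum_le_card_mul_sum_pow (s := Finset.univ) (f := fun c : Fin 3 => incRunSup u h (ω c))
          (fun c _ => incRunSup_nonneg u h (ω c)) 3
    _ = 27 * ∑ c, incRunSup u h (ω c) ^ 4 := by norm_num [Finset.card_univ, Fintype.card_fin]

/-- **Pointwise bound of the sliced sausage integrand** by a constant plus the fourth-moment
functionals of the two lines: `ofReal ((2(R + √2(S(ω₀) + S(ω))))³) ≤ ofReal (1 + 128R⁴)
+ 110592 Σ_c ofReal (M_c(ω₀)⁴) + 110592 Σ_c ofReal (M_c(ω)⁴)`, `M_c(ω) = incRunSup u h (ω c)`,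
`S = Σ_c M_c` (`SausageMoment.sausage_cube_le`, `sum_incRunSup_pow_four_le`, `4096 · 27 = 110592`).
[folklore] -/
theorem ofReal_slice_cube_le (R : ℝ) (u h : ℝ≥0) (ω₀ ω : Fin 3 → (ℝ≥0 → ℝ)) :
    ENNReal.ofReal ((2 * (R + Real.sqrt 2 *
        ((∑ c, incRunSup u h (ω₀ c)) + ∑ c, incRunSup u h (ω c)))) ^ 3) ≤
      ENNReal.ofReal (1 + 128 * R ^ 4) + 110592 * ∑ c, ENNReal.ofReal (incRunSup u h (ω₀ c) ^ 4) +
        110592 * ∑ c, ENNReal.ofReal (incRunSup u h (ω c) ^ 4) := by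
  have h4a : 0 ≤ ∑ c, incRunSup u h (ω₀ c) ^ 4 := Finset.sum_nonneg fun c _ => by positivity
  have h4b : 0 ≤ ∑ c, incRunSup u h (ω c) ^ 4 := Finset.sum_nonneg fun c _ => by positivity
  have hR4 : 0 ≤ 1 + 128 * R ^ 4 := by positivity
  have h1 := SausageMoment.sausage_cube_le R (∑ c, incRunSup u h (ω₀ c)) (∑ c, incRunSup u h (ω c))
  have h2 := sum_incRunSup_pow_four_le u h ω₀
  have h3 := sum_incRunSup_pow_four_le u h ω
  calc ENNReal.ofReal ((2 * (R + Real.sqrt 2 *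
          ((∑ c, incRunSup u h (ω₀ c)) + ∑ c, incRunSup u h (ω c)))) ^ 3)
      ≤ ENNReal.ofReal (1 + 128 * R ^ 4 + 110592 * (∑ c, incRunSup u h (ω₀ c) ^ 4) +
          110592 * ∑ c, incRunSup u h (ω c) ^ 4) := ENNReal.ofReal_le_ofReal (by linarith)
    _ = ENNReal.ofReal (1 + 128 * R ^ 4) + 110592 * ∑ c, ENNReal.ofReal (incRunSup u h (ω₀ c) ^ 4) +
          110592 * ∑ c, ENNReal.ofReal (incRunSup u h (ω c) ^ 4) := by
        rw [ENNReal.ofReal_add (add_nonneg hR4 (mul_nonneg (by norm_num) h4a))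
            (mul_nonneg (by norm_num) h4b),
          ENNReal.ofReal_add hR4 (mul_nonneg (by norm_num) h4a),
          ENNReal.ofReal_mul (by norm_num : (0 : ℝ) ≤ 110592),
          ENNReal.ofReal_mul (by norm_num : (0 : ℝ) ≤ 110592),
          ENNReal.ofReal_sum_of_nonneg (fun c _ => by positivity),
          ENNReal.ofReal_sum_of_nonneg (fun c _ => by positivity)]
        norm_num

/-! ### Integration: marginals and the fourth moment -/

/-- The fourth-moment functional `ω ↦ 110592 Σ_c ofReal (incRunSup u h (ω c)⁴)` of one line is
measurable (`measurable_incRunSup'`, `measurable_pi_apply`). [folklore] -/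
theorem measurable_sliceQuarticFunctional (u h : ℝ≥0) :
    Measurable fun ω : Fin 3 → (ℝ≥0 → ℝ) =>
      (110592 : ℝ≥0∞) * ∑ c, ENNReal.ofReal (incRunSup u h (ω c) ^ 4) := by
  have hm : Measurable fun ω : Fin 3 → (ℝ≥0 → ℝ) =>
      (110592 : ℝ≥0∞) * ∑ c, ENNReal.ofReal (incRunSup u h (ω c) ^ 4) :=
    (Finset.measurable_sum (Finset.univ : Finset (Fin 3)) fun c _ =>
      ENNReal.measurable_ofReal.comp
        (((measurable_incRunSup' u h).comp (measurable_pi_apply c)).pow_const 4)).const_mul _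
  exact hm

/-- **One-coordinate marginal**: under `wienerLine = ⨂_{c<3} preWienerMeasure` each coordinate
`ω c` has the pre-Wiener law (`MeasureTheory.measurePreserving_eval`), so
`∫ ofReal (incRunSup u h (ω c)⁴) d wienerLine ≤ ofReal (18 h²)` (`lintegral_incRunSup_pow_four_le`).
[folklore] -/
theorem lintegral_incRunSup_apply_pow_four_le (u h : ℝ≥0) (c : Fin 3) :
    ∫⁻ ω, ENNReal.ofReal (incRunSup u h (ω c) ^ 4) ∂wienerLine ≤ ENNReal.ofReal (18 * (h : ℝ) ^ 2) := by
  haveI := Literature.Probability.RandomPlanarGeometry.isProbabilityMeasure_preWienerMeasure'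
  have hmp : MeasurePreserving (Function.eval c) wienerLine preWienerMeasure :=
    measurePreserving_eval (fun _ : Fin 3 => preWienerMeasure) c
  have hmeas : Measurable fun η : ℝ≥0 → ℝ => ENNReal.ofReal (incRunSup u h η ^ 4) :=
    ENNReal.measurable_ofReal.comp ((measurable_incRunSup' u h).pow_const 4)
  calc ∫⁻ ω, ENNReal.ofReal (incRunSup u h (ω c) ^ 4) ∂wienerLine
      = ∫⁻ η, ENNReal.ofReal (incRunSup u h η ^ 4) ∂preWienerMeasure := hmp.lintegral_comp hmeas
    _ ≤ ENNReal.ofReal (18 * (h : ℝ) ^ 2) := lintegral_incRunSup_pow_four_le u h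

/-- **The fourth-moment functional integrates to at most `110592 · 3 · ofReal (18 h²)`**
(`lintegral_const_mul`, `lintegral_finsetSum`, three marginals). [folklore] -/
theorem lintegral_sliceQuarticFunctional_le (u h : ℝ≥0) :
    ∫⁻ ω, (110592 : ℝ≥0∞) * ∑ c, ENNReal.ofReal (incRunSup u h (ω c) ^ 4) ∂wienerLine ≤
      110592 * (3 * ENNReal.ofReal (18 * (h : ℝ) ^ 2)) := by
  have hmk : ∀ c : Fin 3,
      Measurable fun ω : Fin 3 → (ℝ≥0 → ℝ) => ENNReal.ofReal (incRunSup u h (ω c) ^ 4) := fun c => by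
    have hm : Measurable fun ω : Fin 3 → (ℝ≥0 → ℝ) => ENNReal.ofReal (incRunSup u h (ω c) ^ 4) :=
      ENNReal.measurable_ofReal.comp
        (((measurable_incRunSup' u h).comp (measurable_pi_apply c)).pow_const 4)
    exact hm
  rw [lintegral_const_mul _ (Finset.measurable_sum _ fun c _ => hmk c),
    lintegral_finsetSum _ fun c _ => hmk c]
  calc (110592 : ℝ≥0∞) * ∑ c, ∫⁻ ω, ENNReal.ofReal (incRunSup u h (ω c) ^ 4) ∂wienerLine
      ≤ 110592 * ∑ _c : Fin 3, ENNReal.ofReal (18 * (h : ℝ) ^ 2) := by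
        gcongr with c
        exact lintegral_incRunSup_apply_pow_four_le u h c
    _ = 110592 * (3 * ENNReal.ofReal (18 * (h : ℝ) ^ 2)) := by
        simp only [Finset.sum_const, Finset.card_univ, Fintype.card_fin, nsmul_eq_mul, Nat.cast_ofNat]

/-- **The double integral on the slice `[u, u + h]`**:
`∫∫ ofReal ((2(R + √2(S_{u,h}(ω₀) + S_{u,h}(ω))))³) d wienerLine d wienerLine
  ≤ ofReal (1 + 128 R⁴) + 2 · (110592 · (3 · ofReal (18 h²)))` — finite, polynomial in `h`,
independent of `u`. [folklore] -/
theorem lintegral_slice_cube_le (R : ℝ) (u h : ℝ≥0) :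
    ∫⁻ ω₀, ∫⁻ ω, ENNReal.ofReal ((2 * (R + Real.sqrt 2 *
        ((∑ c, incRunSup u h (ω₀ c)) + ∑ c, incRunSup u h (ω c)))) ^ 3) ∂wienerLine ∂wienerLine ≤
      ENNReal.ofReal (1 + 128 * R ^ 4) + 2 * (110592 * (3 * ENNReal.ofReal (18 * (h : ℝ) ^ 2))) :=
  SausageMoment.lintegral_lintegral_le_of_le_add wienerLine
    (G := fun ω : Fin 3 → (ℝ≥0 → ℝ) =>
      (110592 : ℝ≥0∞) * ∑ c, ENNReal.ofReal (incRunSup u h (ω c) ^ 4))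
    (measurable_sliceQuarticFunctional u h) (fun ω₀ ω => ofReal_slice_cube_le R u h ω₀ ω)
    (lintegral_sliceQuarticFunctional_le u h)

end Summit.AtomisticToContinuum.BoseEinsteinCondensation.Cruxes.TwoReplicaTransienceBound.TracerDecoupling.SliceMoment

namespace Summit.AtomisticToContinuum.BoseEinsteinCondensation.Cruxes.TwoReplicaTransienceBound.TracerDecoupling

open Literature.Probability.Process (incRunSup)

/-- **Registered stub `stub_sliceMoment`** (crux stmt-AtomisticToContinuum-9687, line `SketchIdeator1`,
skeleton v7): the per-slice cubic Wiener-sausage moment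
`E_{ω₀,ω}[(2(R + √2(S_{u,h}(ω₀) + S_{u,h}(ω))))³]`, `S_{u,h}(ω) = Σ_{c<3} incRunSup u h (ω c)`, is at most
`ofReal (1 + 128R⁴) + 2·(110592·(3·ofReal (18 h²)))`, uniformly in the slice start `u`
(`SliceMoment.lintegral_slice_cube_le`). -/
theorem stub_sliceMoment :
    ∀ (R : ℝ) (u h : ℝ≥0),
      ∫⁻ ω₀, ∫⁻ ω, ENNReal.ofReal ((2 * (R + Real.sqrt 2 *
          ((∑ c, incRunSup u h (ω₀ c)) + ∑ c, incRunSup u h (ω c)))) ^ 3) ∂wienerLine ∂wienerLine ≤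
        ENNReal.ofReal (1 + 128 * R ^ 4) + 2 * (110592 * (3 * ENNReal.ofReal (18 * (h : ℝ) ^ 2))) :=
  fun R u h => SliceMoment.lintegral_slice_cube_le R u h

end Summit.AtomisticToContinuum.BoseEinsteinCondensation.Cruxes.TwoReplicaTransienceBound.TracerDecoupling

end
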